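import Literature.Analysis.OperatorTheory.YangMillsMatrixModelWeakEigenbasis
import HarnessLib

/-!
# `|·|`-stability of the invariant `C²_c` core of Lüscher's form (Beurling–Deny regularisation)

Topic `Literature/Analysis/OperatorTheory`; companion of `YangMillsMatrixModelCoreRellich.lean` /
`YangMillsMatrixModelWeakEigenbasis.lean` (the Kato datum `(V, ι, S)` of Lüscher's form `𝔮` on the invariant `C²_c` core,
for an abstract feature map `T`).  The simplicity criterion for the lowest form level,
`Literature.Analysis.UnboundedOperators.sInf_coreLevelSet_zero_lt_one` (Lieb–Loss Thm 11.8 / Reed–Simon IV XIII.48 in core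
language; input of the discharge of `LuscherSimonGap`), needs besides the datum and positivity the hypothesis

  `habs : ∀ (f : V) (ε > 0), ∃ f' : V, ‖ι f' − |ι f|‖ ≤ ε ∧ ‖f'‖ ≤ ‖f‖ + ε`

("the core is stable under `|·|` up to `ε` without raising the form norm").  This file proves it for the invariant
`C²_c` core (§2, `coreMap_abs_stability`), by the BEURLING–DENY REGULARISATION (§1): for a test function `ψ` and `δ > 0`,
`φ_δ := √(ψ² + δ²) − δ` is again an invariant `C²_c` function (same support), with `0 ≤ φ_δ ≤ |ψ|`, `|φ_δ − |ψ|| ≤ δ`,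
`∂_p φ_δ = (ψ/√(ψ²+δ²)) ∂_p ψ` hence `‖∇φ_δ‖ ≤ ‖∇ψ‖`, so `𝔮(φ_δ) ≤ 𝔮(ψ)`, `‖φ_δ‖ ≤ ‖ψ‖` and
`‖φ_δ − |ψ|‖²_{L²} ≤ δ² · vol(tsupport ψ)`.

Theorems only: no definitions, no named facts, no instances, no notation.  NOT a claim about any gap.

## References
* [LiebLoss2001] E. H. Lieb, M. Loss, *Analysis*, 2nd ed., Thm 6.17 (derivative of `|f|`), Thm 7.8 (`‖∇|f|‖ ≤ ‖∇f‖`),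
  Thm 11.8 (lowest eigenfunction).
* [ReedSimonIV1978] M. Reed, B. Simon, *Methods of Modern Mathematical Physics IV* (1978), Thm XIII.48 ff. (Beurling–Deny
  criteria).
-/

noncomputable section

open MeasureTheory Filter Topology Real
open scoped InnerProductSpace BigOperators

namespace Literature.Analysis.OperatorTheory.YMMatrixModel

/-! ### §1. The regularised absolute value `φ_δ = √(ψ² + δ²) − δ` -/

section Reg

variable {ψ : ZM → ℝ} {δ : ℝ}

/-- `t² + δ² ≠ 0` for `δ > 0`. [cite: LiebLoss2001, Thm. 6.17] -/
theorem sq_add_sq_ne_zero (hδ : 0 < δ) (t : ℝ) : t ^ 2 + δ ^ 2 ≠ 0 := by positivity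

/-- Pointwise: `0 ≤ √(t² + δ²) − δ ≤ |t|` and `|t| − δ ≤ √(t² + δ²) − δ` (`δ > 0`). [cite: LiebLoss2001, Thm. 6.17] -/
theorem absReg_bounds (hδ : 0 < δ) (t : ℝ) :
    0 ≤ Real.sqrt (t ^ 2 + δ ^ 2) - δ ∧ Real.sqrt (t ^ 2 + δ ^ 2) - δ ≤ |t| ∧
      |t| - δ ≤ Real.sqrt (t ^ 2 + δ ^ 2) - δ := by
  have h0 : 0 ≤ Real.sqrt (t ^ 2 + δ ^ 2) := Real.sqrt_nonneg _
  have hsq : Real.sqrt (t ^ 2 + δ ^ 2) ^ 2 = t ^ 2 + δ ^ 2 := Real.sq_sqrt (by positivity)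
  have h1 : δ ≤ Real.sqrt (t ^ 2 + δ ^ 2) :=
    calc δ = Real.sqrt (δ ^ 2) := (Real.sqrt_sq hδ.le).symm
      _ ≤ Real.sqrt (t ^ 2 + δ ^ 2) := Real.sqrt_le_sqrt (by nlinarith [sq_nonneg t])
  have h2 : |t| ≤ Real.sqrt (t ^ 2 + δ ^ 2) :=
    calc |t| = Real.sqrt (t ^ 2) := (Real.sqrt_sq_eq_abs t).symm
      _ ≤ Real.sqrt (t ^ 2 + δ ^ 2) := Real.sqrt_le_sqrt (by nlinarith)
  have h3 : Real.sqrt (t ^ 2 + δ ^ 2) ≤ |t| + δ :=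
    Real.sqrt_le_iff.mpr ⟨by positivity, by nlinarith [sq_abs t, abs_nonneg t]⟩
  exact ⟨by linarith, by linarith, by linarith⟩

/-- `√(t² + δ²) − δ = 0 ↔ t = 0` (`δ > 0`). [cite: LiebLoss2001, Thm. 6.17] -/
theorem absReg_eq_zero_iff (hδ : 0 < δ) (t : ℝ) : Real.sqrt (t ^ 2 + δ ^ 2) - δ = 0 ↔ t = 0 := by
  constructor
  · intro h
    have h1 : Real.sqrt (t ^ 2 + δ ^ 2) = δ := by linarith
    have h2 := Real.sq_sqrt (by positivity : (0 : ℝ) ≤ t ^ 2 + δ ^ 2)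
    rw [h1] at h2
    nlinarith [sq_nonneg t]
  · rintro rfl
    simp [Real.sqrt_sq hδ.le]

/-- `φ_δ` is `C²` when `ψ` is. [cite: LiebLoss2001, Thm. 6.17] -/
theorem contDiff_absReg (hψ : ContDiff ℝ 2 ψ) (hδ : 0 < δ) :
    ContDiff ℝ 2 fun x => Real.sqrt (ψ x ^ 2 + δ ^ 2) - δ :=
  ((hψ.pow 2).add contDiff_const).sqrt (fun x => sq_add_sq_ne_zero hδ (ψ x)) |>.sub contDiff_const

/-- `φ_δ` has the same support as `ψ`, hence compact support. [cite: LiebLoss2001, Thm. 6.17] -/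
theorem hasCompactSupport_absReg (hψs : HasCompactSupport ψ) (hδ : 0 < δ) :
    HasCompactSupport fun x => Real.sqrt (ψ x ^ 2 + δ ^ 2) - δ := by
  refine hψs.mono fun x hx => ?_
  rw [Function.mem_support] at hx ⊢
  intro h0
  exact hx ((absReg_eq_zero_iff hδ (ψ x)).mpr h0)

/-- `φ_δ` is a test function when `ψ` is. [cite: LiebLoss2001, Thm. 6.17] -/
theorem isTestFn_absReg (hψ : IsTestFn ψ) (hδ : 0 < δ) : IsTestFn fun x => Real.sqrt (ψ x ^ 2 + δ ^ 2) - δ :=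
  ⟨contDiff_absReg hψ.1 hδ, hasCompactSupport_absReg hψ.2 hδ⟩

/-- `φ_δ` is colour-rotation invariant when `ψ` is. [cite: LiebLoss2001, Thm. 6.17] -/
theorem isGaugeInv_absReg (hψ : IsGaugeInv ψ) (δ : ℝ) : IsGaugeInv fun x => Real.sqrt (ψ x ^ 2 + δ ^ 2) - δ :=
  fun R hR x => by simp only [hψ R hR x]

/-- **Chain rule**: `∂_p φ_δ(x) = (ψ(x)/√(ψ(x)²+δ²)) · ∂_p ψ(x)`. [cite: LiebLoss2001, Thm. 6.17] -/
theorem pderiv_absReg (hψ : Differentiable ℝ ψ) (hδ : 0 < δ) (p : Fin 3 × Fin 3) (x : ZM) :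
    pderiv p (fun x => Real.sqrt (ψ x ^ 2 + δ ^ 2) - δ) x =
      ψ x / Real.sqrt (ψ x ^ 2 + δ ^ 2) * pderiv p ψ x := by
  -- the scalar function `G t = √(t² + δ²) − δ` and its derivative
  have hG : ∀ t : ℝ, HasDerivAt (fun t : ℝ => Real.sqrt (t ^ 2 + δ ^ 2) - δ) (t / Real.sqrt (t ^ 2 + δ ^ 2)) t := by
    intro t
    have h1 : HasDerivAt (fun t : ℝ => t ^ 2 + δ ^ 2) (2 * t) t := by
      simpa using ((hasDerivAt_pow 2 t).add_const (δ ^ 2))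
    have h2 := (h1.sqrt (sq_add_sq_ne_zero hδ t)).sub_const δ
    have e : 2 * t / (2 * Real.sqrt (t ^ 2 + δ ^ 2)) = t / Real.sqrt (t ^ 2 + δ ^ 2) := by
      rw [mul_div_mul_left _ _ (two_ne_zero)]
    rw [e] at h2
    exact h2
  have hcomp : HasFDerivAt (fun x => Real.sqrt (ψ x ^ 2 + δ ^ 2) - δ)
      ((ψ x / Real.sqrt (ψ x ^ 2 + δ ^ 2)) • fderiv ℝ ψ x) x :=
    (hG (ψ x)).comp_hasFDerivAt x (hψ x).hasFDerivAt
  rw [pderiv, hcomp.fderiv]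
  rfl

/-- `|∂_p φ_δ| ≤ |∂_p ψ|` (the factor `ψ/√(ψ²+δ²)` has modulus `≤ 1`). [cite: LiebLoss2001, Thm. 7.8] -/
theorem sq_pderiv_absReg_le (hψ : Differentiable ℝ ψ) (hδ : 0 < δ) (p : Fin 3 × Fin 3) (x : ZM) :
    pderiv p (fun x => Real.sqrt (ψ x ^ 2 + δ ^ 2) - δ) x ^ 2 ≤ pderiv p ψ x ^ 2 := by
  rw [pderiv_absReg hψ hδ p x, mul_pow, div_pow, Real.sq_sqrt (by positivity)]
  have h1 : ψ x ^ 2 / (ψ x ^ 2 + δ ^ 2) ≤ 1 := by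
    rw [div_le_one (by positivity)]; nlinarith
  nlinarith [sq_nonneg (pderiv p ψ x), div_nonneg (sq_nonneg (ψ x)) (by positivity : (0:ℝ) ≤ ψ x ^ 2 + δ ^ 2)]

/-- `‖∇φ_δ(x)‖² ≤ ‖∇ψ(x)‖²`. [cite: LiebLoss2001, Thm. 7.8] -/
theorem norm_gradient_absReg_sq_le (hψ : Differentiable ℝ ψ) (hδ : 0 < δ) (x : ZM) :
    ‖gradient (fun x => Real.sqrt (ψ x ^ 2 + δ ^ 2) - δ) x‖ ^ 2 ≤ ‖gradient ψ x‖ ^ 2 := by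
  rw [norm_gradient_sq, norm_gradient_sq]
  exact Finset.sum_le_sum fun p _ => sq_pderiv_absReg_le hψ hδ p x

/-- `φ_δ(x)² ≤ ψ(x)²`. [cite: LiebLoss2001, Thm. 6.17] -/
theorem absReg_sq_le (hδ : 0 < δ) (x : ZM) : (Real.sqrt (ψ x ^ 2 + δ ^ 2) - δ) ^ 2 ≤ ψ x ^ 2 := by
  obtain ⟨h0, h1, -⟩ := absReg_bounds hδ (ψ x)
  calc (Real.sqrt (ψ x ^ 2 + δ ^ 2) - δ) ^ 2 ≤ |ψ x| ^ 2 := pow_le_pow_left₀ h0 h1 2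
    _ = ψ x ^ 2 := sq_abs _

/-- **The regularisation does not raise the energy**: `𝔮(φ_δ) ≤ 𝔮(ψ)`. [cite: LiebLoss2001, Thm. 7.8] -/
theorem energyForm_absReg_le (hψ : IsTestFn ψ) (hδ : 0 < δ) :
    energyForm (fun x => Real.sqrt (ψ x ^ 2 + δ ^ 2) - δ) ≤ energyForm ψ := by
  have hφ := isTestFn_absReg hψ hδ
  unfold energyForm
  refine integral_mono ((hφ.integrable_norm_gradient_sq.const_mul _).add (hφ.integrable_mul_sq continuous_luscherPotential))
    ((hψ.integrable_norm_gradient_sq.const_mul _).add (hψ.integrable_mul_sq continuous_luscherPotential)) fun x => ?_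
  exact add_le_add (mul_le_mul_of_nonneg_left (norm_gradient_absReg_sq_le hψ.differentiable hδ x) (by norm_num))
    (mul_le_mul_of_nonneg_left (absReg_sq_le hδ x) (luscherPotential_nonneg x))

/-- `‖φ_δ‖²_{L²} ≤ ‖ψ‖²_{L²}`. [cite: LiebLoss2001, Thm. 6.17] -/
theorem l2sq_absReg_le (hψ : IsTestFn ψ) (hδ : 0 < δ) : l2sq (fun x => Real.sqrt (ψ x ^ 2 + δ ^ 2) - δ) ≤ l2sq ψ :=
  integral_mono (isTestFn_absReg hψ hδ).integrable_sq hψ.integrable_sq fun x => absReg_sq_le hδ x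

/-- **`L²`-closeness to `|ψ|`**: `∫ (φ_δ − |ψ|)² ≤ δ² · vol(tsupport ψ)`. [cite: LiebLoss2001, Thm. 6.17] -/
theorem integral_sq_absReg_sub_abs_le (hψ : IsTestFn ψ) (hδ : 0 < δ) :
    ∫ x, (Real.sqrt (ψ x ^ 2 + δ ^ 2) - δ - |ψ x|) ^ 2 ≤ δ ^ 2 * (volume (tsupport ψ)).toReal := by
  have hK : IsCompact (tsupport ψ) := hψ.2
  have hmeas : MeasurableSet (tsupport ψ) := (isClosed_tsupport ψ).measurableSet
  have hpt : ∀ x, (Real.sqrt (ψ x ^ 2 + δ ^ 2) - δ - |ψ x|) ^ 2 ≤ (tsupport ψ).indicator (fun _ => δ ^ 2) x := by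
    intro x
    by_cases hx : x ∈ tsupport ψ
    · rw [Set.indicator_of_mem hx]
      obtain ⟨-, h1, h2⟩ := absReg_bounds hδ (ψ x)
      have h3 : abs (Real.sqrt (ψ x ^ 2 + δ ^ 2) - δ - |ψ x|) ≤ δ := abs_le.2 ⟨by linarith, by linarith⟩
      calc (Real.sqrt (ψ x ^ 2 + δ ^ 2) - δ - |ψ x|) ^ 2 = (abs (Real.sqrt (ψ x ^ 2 + δ ^ 2) - δ - |ψ x|)) ^ 2 :=
            (sq_abs _).symm
        _ ≤ δ ^ 2 := pow_le_pow_left₀ (abs_nonneg _) h3 2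
    · rw [Set.indicator_of_notMem hx]
      have h0 : ψ x = 0 := image_eq_zero_of_notMem_tsupport hx
      simp [h0, Real.sqrt_sq hδ.le]
  calc ∫ x, (Real.sqrt (ψ x ^ 2 + δ ^ 2) - δ - |ψ x|) ^ 2
      ≤ ∫ x, (tsupport ψ).indicator (fun _ => δ ^ 2) x := by
        refine integral_mono_of_nonneg (Eventually.of_forall fun x => sq_nonneg _) ?_ (Eventually.of_forall hpt)
        exact (integrable_indicator_iff hmeas).2 ((integrableOn_const_iff enorm_ne_top).2 (Or.inr hK.measure_lt_top))
    _ = δ ^ 2 * (volume (tsupport ψ)).toReal := by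
        rw [integral_indicator_const _ hmeas, smul_eq_mul, mul_comm, measureReal_def]

end Reg

/-! ### §2. `|·|`-stability of the core space (hypothesis `habs` of the simplicity criterion) -/

section CoreSpace

variable {C : Submodule ℝ (ZM → ℝ)} (hC : ∀ f : C, IsTestFn (f : ZM → ℝ) ∧ IsGaugeInv (f : ZM → ℝ))
  (T : C →ₗ[ℝ] PiLp 2 (fun _ : Option (Option (Fin 3 × Fin 3)) => Lp ℝ 2 (volume : Measure ZM)))
  (hT0 : ∀ f : C, (T f) none = (memLp_two_of_isTestFn (hC f).1).toLp _)
  (hT1 : ∀ f : C, (T f) (some none) = (memLp_two_sqrtPot_of_isTestFn (hC f).1).toLp _)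
  (hT2 : ∀ (f : C) (p : Fin 3 × Fin 3),
    (T f) (some (some p)) = (memLp_two_const_mul_pderiv_of_isTestFn (hC f).1 (Real.sqrt 2)⁻¹ p).toLp _)

/-- The `L²` class of `|ψ|` is the lattice absolute value of the class of `ψ`. [cite: LiebLoss2001, Thm. 6.17] -/
theorem abs_toLp_eq {ψ : ZM → ℝ} (hψ : MemLp ψ 2 (volume : Measure ZM)) :
    |hψ.toLp ψ| = hψ.abs.toLp (fun x => |ψ x|) :=
  Lp.ext (((Lp.coeFn_abs _).trans ((MemLp.coeFn_toLp hψ).mono fun x hx => by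
    show |(hψ.toLp ψ) x| = |ψ x|; rw [hx])).trans (MemLp.coeFn_toLp _).symm)

include hT0 hT1 hT2 in
/-- **Approximation of `|g|` inside the core without raising the feature norm**: for a core function `g` and `ε > 0`
there is a core function `g'` (namely `φ_δ = √(g² + δ²) − δ`, `δ` small) with `‖T g'‖ ≤ ‖T g‖` and
`∫ (g' − |g|)² ≤ ε²`. [cite: LiebLoss2001, Thm. 7.8] -/
theorem exists_core_abs_approx (hCmem : ∀ ψ : ZM → ℝ, IsTestFn ψ → IsGaugeInv ψ → ψ ∈ C) (g : C) {ε : ℝ}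
    (hε : 0 < ε) :
    ∃ g' : C, ‖T g'‖ ≤ ‖T g‖ ∧ ∫ x, ((g' : ZM → ℝ) x - |(g : ZM → ℝ) x|) ^ 2 ≤ ε ^ 2 := by
  have hψ : IsTestFn (g : ZM → ℝ) := (hC g).1
  have hψg : IsGaugeInv (g : ZM → ℝ) := (hC g).2
  -- `δ` with `δ² · vol(tsupport g) ≤ ε²`
  let M : ℝ := (volume (tsupport (g : ZM → ℝ))).toReal
  have hM0 : 0 ≤ M := ENNReal.toReal_nonneg
  let δ : ℝ := ε / (Real.sqrt M + 1)
  have hδdef : δ = ε / (Real.sqrt M + 1) := rfl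
  have hδ : 0 < δ := div_pos hε (by positivity)
  have hδM : δ ^ 2 * M ≤ ε ^ 2 := by
    have h1 : δ * (Real.sqrt M + 1) = ε := by rw [hδdef]; field_simp
    have h2 : δ * Real.sqrt M ≤ ε := by nlinarith [Real.sqrt_nonneg M]
    have h3 : 0 ≤ δ * Real.sqrt M := by positivity
    calc δ ^ 2 * M = (δ * Real.sqrt M) ^ 2 := by rw [mul_pow, Real.sq_sqrt hM0]
      _ ≤ ε ^ 2 := pow_le_pow_left₀ h3 h2 2
  have hφ : IsTestFn fun x => Real.sqrt ((g : ZM → ℝ) x ^ 2 + δ ^ 2) - δ := isTestFn_absReg hψ hδ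
  have hφg : IsGaugeInv fun x => Real.sqrt ((g : ZM → ℝ) x ^ 2 + δ ^ 2) - δ := isGaugeInv_absReg hψg δ
  refine ⟨⟨fun x => Real.sqrt ((g : ZM → ℝ) x ^ 2 + δ ^ 2) - δ, hCmem _ hφ hφg⟩, ?_, ?_⟩
  · -- `‖T φ‖² = ‖φ‖² + 𝔮(φ) ≤ ‖g‖² + 𝔮(g) = ‖T g‖²`
    have h1 := norm_coreMap_sq hC T hT0 hT1 hT2 ⟨fun x => Real.sqrt ((g : ZM → ℝ) x ^ 2 + δ ^ 2) - δ, hCmem _ hφ hφg⟩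
    have h2 := norm_coreMap_sq hC T hT0 hT1 hT2 g
    have h3 : ‖T ⟨fun x => Real.sqrt ((g : ZM → ℝ) x ^ 2 + δ ^ 2) - δ, hCmem _ hφ hφg⟩‖ ^ 2 ≤ ‖T g‖ ^ 2 := by
      rw [h1, h2]
      exact add_le_add (l2sq_absReg_le hψ hδ) (energyForm_absReg_le hψ hδ)
    exact (pow_le_pow_iff_left₀ (norm_nonneg _) (norm_nonneg _) two_ne_zero).mp h3
  · exact (integral_sq_absReg_sub_abs_le hψ hδ).trans hδM

include hT0 hT1 hT2 in
/-- ★ **`|·|`-stability of the invariant `C²_c` core in form norm** (hypothesis `habs` of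
`Literature.Analysis.UnboundedOperators.sInf_coreLevelSet_zero_lt_one` for the datum of Lüscher's form): for every
`f ∈ V = T(C)` and `ε > 0` there is `f' ∈ V` with `‖ι f' − |ι f|‖_{L²} ≤ ε` and `‖f'‖_V ≤ ‖f‖_V + ε` — take
`f' = T(φ_δ)`, `φ_δ = √(ψ² + δ²) − δ`, `ψ = Ψ f`, `δ` small (`exists_core_abs_approx`). [cite: LiebLoss2001, Thm. 7.8] -/
theorem coreMap_abs_stability (hCmem : ∀ ψ : ZM → ℝ, IsTestFn ψ → IsGaugeInv ψ → ψ ∈ C)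
    (Ψ : LinearMap.range T ≃ₗ[ℝ] C)
    (hTΨ : ∀ v : LinearMap.range T,
      T (Ψ v) = (v : PiLp 2 (fun _ : Option (Option (Fin 3 × Fin 3)) => Lp ℝ 2 (volume : Measure ZM))))
    (hΨT : ∀ f : C, Ψ ⟨T f, LinearMap.mem_range_self T f⟩ = f)
    (ι : LinearMap.range T →L[ℝ] Lp ℝ 2 (volume : Measure ZM))
    (hι : ∀ v : LinearMap.range T, ι v = (memLp_two_of_isTestFn (hC (Ψ v)).1).toLp _)
    (f : LinearMap.range T) {ε : ℝ} (hε : 0 < ε) :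
    ∃ f' : LinearMap.range T, ‖ι f' - |ι f|‖ ≤ ε ∧ ‖f'‖ ≤ ‖f‖ + ε := by
  obtain ⟨g', hg'norm, hg'int⟩ := exists_core_abs_approx hC T hT0 hT1 hT2 hCmem (Ψ f) hε
  refine ⟨⟨T g', LinearMap.mem_range_self T g'⟩, ?_, ?_⟩
  · -- `‖ι f' − |ι f|‖² = ∫ (g' − |Ψ f|)² ≤ ε²`, transported term-mode along `hι`, `hΨT`
    have hF : ∀ v : LinearMap.range T,
        ι v = (fun g : C => (memLp_two_of_isTestFn (hC g).1).toLp (g : ZM → ℝ)) (Ψ v) := hι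
    have hιf' : ι ⟨T g', LinearMap.mem_range_self T g'⟩ = (memLp_two_of_isTestFn (hC g').1).toLp _ :=
      (hF _).trans (congrArg (fun g : C => (memLp_two_of_isTestFn (hC g).1).toLp (g : ZM → ℝ)) (hΨT g'))
    have hιf : |ι f| = (memLp_two_of_isTestFn (hC (Ψ f)).1).abs.toLp (fun x => |(Ψ f : ZM → ℝ) x|) :=
      (congrArg (fun z : Lp ℝ 2 (volume : Measure ZM) => |z|) (hι f)).trans (abs_toLp_eq _)
    have hdiff : ι ⟨T g', LinearMap.mem_range_self T g'⟩ - |ι f| =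
        ((memLp_two_of_isTestFn (hC g').1).sub (memLp_two_of_isTestFn (hC (Ψ f)).1).abs).toLp
          (fun x => (g' : ZM → ℝ) x - |(Ψ f : ZM → ℝ) x|) :=
      (congrArg₂ (fun a b => a - b) hιf' hιf).trans (MemLp.toLp_sub _ _).symm
    have hsq : ‖ι ⟨T g', LinearMap.mem_range_self T g'⟩ - |ι f|‖ ^ 2 ≤ ε ^ 2 := by
      rw [hdiff, ← real_inner_self_eq_norm_sq, inner_toLp_toLp]
      calc ∫ x, ((g' : ZM → ℝ) x - |(Ψ f : ZM → ℝ) x|) * ((g' : ZM → ℝ) x - |(Ψ f : ZM → ℝ) x|)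
          = ∫ x, ((g' : ZM → ℝ) x - |(Ψ f : ZM → ℝ) x|) ^ 2 :=
            integral_congr_ae (Eventually.of_forall fun x => by simp only [sq])
        _ ≤ ε ^ 2 := hg'int
    exact (pow_le_pow_iff_left₀ (norm_nonneg _) hε.le two_ne_zero).mp hsq
  · -- `‖f'‖ = ‖T g'‖ ≤ ‖T (Ψ f)‖ = ‖f‖`
    have h0 : ‖f‖ = ‖T (Ψ f)‖ := by rw [hTΨ f]; rfl
    have h1 : ‖(⟨T g', LinearMap.mem_range_self T g'⟩ : LinearMap.range T)‖ = ‖T g'‖ := rfl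
    rw [h1, h0]
    linarith

end CoreSpace

end Literature.Analysis.OperatorTheory.YMMatrixModel

end
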